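import Mathlib
import Summits.NavierStokesRegularity.NavierStokesRegularity.Theses.SubcriticalEnvelope
import Summits.NavierStokesRegularity.NavierStokesRegularity.Theorems.SubcriticalEnvelopeViscousTailEnvelopeOrthant
import Summits.NavierStokesRegularity.NavierStokesRegularity.Theorems.SubOnsagerCeilingOrthantTailCeilingDyadicRatioTwo
import HarnessLib

/-!
# `SubcriticalEnvelope.ForwardSourceTailEnvelopeKP` (stmt-NavierStokesRegularity-27130) — the BC5
RUNG: the crux's per-table clause HOLDS on the scaled one-mode dyadic tables at scale ratio `2`
(helper file, `--supports`)

The route's two-layer plan (Theses/SubcriticalEnvelope.lean, «BC5 (plan-only): first rung = A⁺ on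
the embedded scalar dyadic table at ratio 2 (S = {0}, T⁺ = T) with ν-uniform C via BMR/Cheskidov
flux positivity») is paid here in the kernel, through the skeleton of record «via-ceiling»
(27057 ⇒ 27130, `Theorems.forwardSourceTailEnvelopeKP_of_forwardTailCeilingKP`):

* `subOnsagerCeiling_ceilingAt_of_shellBarrierAt` — a two-level weighted SHELL BARRIER
  (`ShellBarrierAt R ε₀ α`: `(1+ε₀)^{2θk}·½X_{i,k}(t)² ≤ D·E₀`, `θ > 1/2`) gives the TAIL CEILING
  (`CeilingAt R ε₀ α`, constant `4D/(1 − (1+ε₀)^{-2θ})`) by a geometric series — the glue lemma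
  of the registered skeletons «shell-barrier» / «fwd-shell-barrier» / «kp-shell-barrier»
  (Cruxes/…/Lines/, not built as modules), landed here as an importable theorem (proof verbatim);
* `forwardSourceTailEnvelopeKP_at_dyadicRatioTwo` — for every spread `R ≥ 1` and every scaled
  dyadic table `α = c·dyadicTable` (`IsScaledDyadic α`), the clause of `ForwardSourceTailEnvelopeKP`
  after its binders `R, εs, ε₀` holds AT `ε₀ = 1`: mode set `S = univ`, margin `η = 1/50`
  (`= 2θ − 1`, `θ = 51/100`), window constant `C·Σ½X₀²` uniform in `T` and `ν` — from the LANDED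
  rung `SubOnsagerCeiling.stub_dyadicRatioTwo` (p610572: Barbato–Morandin–Romito 2011 at `λ = 2`,
  `β = 5/2`, transported to Tao's lattice), the shell-barrier ⇒ ceiling glue above, and
  `viscousTailEnvelopeOrthant_uniform_of_ceilingAt` (cone invariance + exponent bookkeeping).

This is the witness-of-weakness of BOTH regime stubs of SOC's «kp-shell-barrier» restricted to the
chain class at the one ratio in print; every other ratio is open in print (KEY-NS #124 (B)).

HONEST FRAMING: statements about Tao-type MODEL lattice ODEs (rung TL-M2Break); the crux 27130 is
NOT proved (one table class, one ratio); nothing here bears on the Navier–Stokes equations and NS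
regularity is NOT advanced.
-/

noncomputable section

-- the sub-problem namespace `NavierStokesRegularity.NavierStokesRegularity` is the tree's layout (D-0017)
set_option linter.dupNamespace false

namespace Summit.NavierStokesRegularity.NavierStokesRegularity.Theorems

open Set
open Literature.Analysis.FluidPDE.TaoCascade
open Summit.NavierStokesRegularity.NavierStokesRegularity.Theses
open Summit.NavierStokesRegularity.NavierStokesRegularity.Theorems.SubOnsagerCeiling

/-- **Shell barrier ⇒ tail ceiling** (geometric series): a `ν`-uniform two-level weighted per-shell
bound `(1+ε₀)^{2θk}·½X_{i,k}(t)² ≤ D·E₀` along the honest viscous solutions that are non-negative on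
shells `≥ 1` (`ShellBarrierAt R ε₀ α`, `θ > 1/2`, `D ≥ 0`) gives the sub-Onsager tail ceiling
`Σ_{k=n..N} Σ_i ½X_{i,k}(t)² ≤ (4D/(1−r))·E₀·(1+ε₀)^{-2θn}`, `r = (1+ε₀)^{-2θ} < 1`
(`CeilingAt R ε₀ α`).  Proof verbatim from the registered skeletons «shell-barrier» (planner
ns-idea-1 g4) / «kp-shell-barrier» (LEAD ns-soc-p2 g3), where it is proved but not importable.
MODEL lattice bookkeeping. [this file] -/
theorem subOnsagerCeiling_ceilingAt_of_shellBarrierAt {R ε₀ : ℝ} (hε : 0 < ε₀)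
    {α : Fin 4 → Fin 4 → Fin 4 → ℤ × ℤ × ℤ → ℝ} (h : ShellBarrierAt R ε₀ α) : CeilingAt R ε₀ α := by
  intro hT hO
  obtain ⟨θ, hθ, D, hD, H⟩ := h hT hO
  have hb : (1 : ℝ) < 1 + ε₀ := by linarith
  have hb0 : (0 : ℝ) ≤ 1 + ε₀ := by linarith
  set r : ℝ := (1 + ε₀) ^ (-(2 * θ)) with hr_def
  have hr0 : 0 < r := Real.rpow_pos_of_pos (by linarith) _
  have hr1 : r < 1 := by
    have : (1 + ε₀) ^ (-(2 * θ)) < (1 + ε₀) ^ (0 : ℝ) :=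
      Real.rpow_lt_rpow_of_exponent_lt hb (by linarith)
    simpa [hr_def] using this
  have h1r : 0 < 1 - r := by linarith
  refine ⟨θ, hθ, 4 * D / (1 - r), by positivity, ?_⟩
  intro ν hν X₀ s hs X hdat hvan hbdd hcont hode hnn n N hnN t ht
  set E₀ : ℝ := ∑ j : Fin 4, (1 / 2 : ℝ) * X₀ j ^ 2 with hE₀
  have hE₀0 : 0 ≤ E₀ := Finset.sum_nonneg fun j _ => by positivity
  have hpow : ∀ k : ℕ, (1 + ε₀) ^ (2 * θ * (k : ℝ)) * r ^ k = 1 := by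
    intro k
    rw [hr_def, ← Real.rpow_mul_natCast hb0, ← Real.rpow_add (by linarith)]
    have : 2 * θ * (k : ℝ) + -(2 * θ) * (k : ℝ) = 0 := by ring
    rw [this, Real.rpow_zero]
  have hshell : ∀ k : ℕ, ∑ i : Fin 4, (1 / 2 : ℝ) * X i (k : ℤ) t ^ 2 ≤ 4 * D * E₀ * r ^ k := by
    intro k
    have hk : ∀ i : Fin 4, (1 / 2 : ℝ) * X i (k : ℤ) t ^ 2 ≤ D * E₀ * r ^ k := by
      intro i
      have Hi := H ν hν X₀ s hs X hdat hvan hbdd hcont hode hnn t ht i k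
      have hrk : 0 < r ^ k := pow_pos hr0 k
      have := mul_le_mul_of_nonneg_right Hi hrk.le
      calc (1 / 2 : ℝ) * X i (k : ℤ) t ^ 2
          = ((1 + ε₀) ^ (2 * θ * (k : ℝ)) * r ^ k) * ((1 / 2 : ℝ) * X i (k : ℤ) t ^ 2) := by
            rw [hpow k, one_mul]
        _ = (1 + ε₀) ^ (2 * θ * (k : ℝ)) * ((1 / 2 : ℝ) * X i (k : ℤ) t ^ 2) * r ^ k := by ring
        _ ≤ D * (∑ j : Fin 4, (1 / 2 : ℝ) * X₀ j ^ 2) * r ^ k := this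
        _ = D * E₀ * r ^ k := by rw [hE₀]
    calc ∑ i : Fin 4, (1 / 2 : ℝ) * X i (k : ℤ) t ^ 2
        ≤ ∑ _i : Fin 4, D * E₀ * r ^ k := Finset.sum_le_sum fun i _ => hk i
      _ = 4 * D * E₀ * r ^ k := by simp [Finset.sum_const, Finset.card_univ, Fintype.card_fin]; ring
  have hgeom : ∑ k ∈ Finset.Icc n N, r ^ k ≤ r ^ n / (1 - r) := by
    rw [← Finset.Ico_add_one_right_eq_Icc]
    exact geom_sum_Ico_le_of_lt_one hr0.le hr1
  have hrn : r ^ n = (1 + ε₀) ^ (-(2 * θ * (n : ℝ))) := by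
    rw [hr_def, ← Real.rpow_mul_natCast hb0]
    congr 1; ring
  calc ∑ k ∈ Finset.Icc n N, ∑ i : Fin 4, (1 / 2 : ℝ) * X i (k : ℤ) t ^ 2
      ≤ ∑ k ∈ Finset.Icc n N, 4 * D * E₀ * r ^ k := Finset.sum_le_sum fun k _ => hshell k
    _ = 4 * D * E₀ * ∑ k ∈ Finset.Icc n N, r ^ k := by rw [Finset.mul_sum (s := Finset.Icc n N)]
    _ ≤ 4 * D * E₀ * (r ^ n / (1 - r)) :=
        mul_le_mul_of_nonneg_left hgeom (by positivity)
    _ = 4 * D / (1 - r) * E₀ * (1 + ε₀) ^ (-(2 * θ * (n : ℝ))) := by rw [← hrn]; field_simp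
    _ = 4 * D / (1 - r) * (∑ i : Fin 4, (1 / 2 : ℝ) * X₀ i ^ 2) * (1 + ε₀) ^ (-(2 * θ * (n : ℝ))) := by
        rw [hE₀]

/-- **BC5 RUNG of 27130: the KP forward-source envelope clause HOLDS on the scaled dyadic tables at
scale ratio `2`.**  For every spread `R ≥ 1`, `ε₀ = 1` and every `α = c·dyadicTable` (`c > 0`) the
clause of `ForwardSourceTailEnvelopeKP` after its binders `R, εs, ε₀` holds: `S = univ` (trivially
source-complete), for every one-shell datum `η = 2θ − 1 > 0` (`θ = 51/100`), and on every window
ONE constant `C·Σ_j ½X₀_j²`, uniform in `T` and in `ν > 0`, bounds the tail sums of every honest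
`ν`-viscous solution on `[0,s] ⊆ [0,T]`.  Chain: `stub_dyadicRatioTwo` (BMR 2011 at `λ = 2`,
landed p610572) ⇒ shell barrier ⇒ ceiling (`subOnsagerCeiling_ceilingAt_of_shellBarrierAt`) ⇒
window envelope (`viscousTailEnvelopeOrthant_uniform_of_ceilingAt`: cone invariance + exponents).
The orthant and diagonal-feed binders of the crux are hypotheses here (both hold for the chain).
MODEL lattice statement; the crux is NOT proved. [this file] -/
theorem forwardSourceTailEnvelopeKP_at_dyadicRatioTwo :
    ∀ R : ℝ, 1 ≤ R → ∀ ε₀ : ℝ, ε₀ = 1 →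
      ∀ α : Fin 4 → Fin 4 → Fin 4 → ℤ × ℤ × ℤ → ℝ, IsScaledDyadic α →
      InTableClass R α →
      (∀ (Y : Fin 4 → ℤ → ℝ → ℝ) (τ : ℝ), (∀ (j : Fin 4) (k : ℤ), 1 ≤ k → 0 ≤ Y j k τ) →
        ∀ δ : ℝ, 0 < δ → ∀ (i : Fin 4) (n : ℤ), 1 ≤ n → Y i n τ = 0 → 0 ≤ quadTerm δ α Y i n τ) →
      (∀ a b i : Fin 4, a ≠ b → α a b i (0, 0, 1) = 0) →
      ∃ S : Finset (Fin 4), (∀ i, i ∉ S → ∀ j l : Fin 4, α i j l (0, 0, 1) = 0) ∧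
      ∀ X₀ : Fin 4 → ℝ, ∃ η : ℝ, 0 < η ∧ ∀ T : ℝ, 0 < T → ∃ C : ℝ, ∀ ν : ℝ, 0 < ν →
      ∀ s ∈ Set.Ioc (0 : ℝ) T, ∀ X : Fin 4 → ℤ → ℝ → ℝ,
      (∀ i k, X i k 0 = if k = 0 then X₀ i else 0) →
      (∀ i k, k < 0 → ∀ t, X i k t = 0) →
      (∃ M : ℝ, ∀ (t : ℝ) (i : Fin 4) (k : ℤ), (1 + (1 + ε₀) ^ ((10 : ℝ) * k)) * |X i k t| ≤ M) →
      (∀ i k, Continuous (X i k)) →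
      (∀ i k, ∀ t ∈ Set.Icc (0 : ℝ) s, HasDerivWithinAt (X i k)
        (quadTerm ε₀ α X i k t - ν * (1 + ε₀) ^ ((2 : ℝ) * k) * X i k t) (Set.Icc 0 s) t) →
      ∀ n N : ℕ, n ≤ N → ∀ t ∈ Set.Icc (0 : ℝ) s,
        ∑ k ∈ Finset.Icc n N, ∑ i ∈ S, (1 / 2) * X i (k : ℤ) t ^ 2 ≤
          C * (1 + ε₀) ^ (-((1 + η) * (n : ℝ))) := by
  intro R hR ε₀ hε α hsc hα hK _hdiag
  subst hε
  have hceil : CeilingAt R 1 α :=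
    subOnsagerCeiling_ceilingAt_of_shellBarrierAt one_pos (stub_dyadicRatioTwo R hR α hsc)
  obtain ⟨η, hη, C, _hC0, H⟩ := viscousTailEnvelopeOrthant_uniform_of_ceilingAt one_pos hα hK hceil
  refine ⟨Finset.univ, fun i hi => absurd (Finset.mem_univ i) hi, fun X₀ =>
    ⟨η, hη, fun T _hT => ⟨C * (∑ i : Fin 4, (1 / 2 : ℝ) * X₀ i ^ 2),
      fun ν hν s hs X hinit hlow hbd hcont hder n N hnN t ht => ?_⟩⟩⟩
  exact H ν hν X₀ s hs.1 X hinit hlow hbd hcont hder n N hnN t ht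

end Summit.NavierStokesRegularity.NavierStokesRegularity.Theorems

end
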